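import Summits.QuantumFields.YangMills.Theorems.PoincareLipschitzConeLinkCutoff
import Summits.QuantumFields.YangMills.Theorems.PoincareLipschitzConeLinkChartIntegral
import Summits.QuantumFields.YangMills.Theorems.PoincareLipschitzConeLinkDilationLetters
import Literature.Analysis.FunctionSpaces.SobolevDomainProofs
import Mathlib.MeasureTheory.Integral.Prod
import Mathlib.Analysis.Distribution.AEEqOfIntegralContDiff
import HarnessLib


/-!
# Crux `BlockLipschitzL` (stmt-QuantumFields-23533) ∕ `HistoryTailL` (stmt-QuantumFields-19936), LINE 25 «CompactnessTransfer»,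
# stub S1″ — ROAD (H) «SU(2) currents ⇒ H-system ⇒ 8π quantum», brick (T) «CONE → PLANE TRANSPORT», FILE D2 «PUSH-FORWARD FIELDS»

Cell `ym3-torus` (YM ladder rung R3 = continuum SU(2) Yang–Mills on T³ — a RUNG, NOT Clay: not d = 4, not infinite volume,
not a mass gap); WIDTH helper seat `ym3-torus-px14` g7 (brick (T) of px19 g8's ROAD (H), architecture v1; chart letters A1–A3 by
px16 g10).  Helper `--supports stmt-QuantumFields-23533`; THEOREMS ONLY (0 `def`, 0 `sorry`, default heartbeats); imports D1
✓`PoincareLipschitzConeLinkCutoff`, B-letters ✓`PoincareLipschitzConeLinkDilationLetters`, px16 g10's ✓`PoincareLipschitzConeLinkChartIntegral`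
(the change of variables `∫_{‖x‖∈T} g = ∫_{T×E²} (t²c(y)²) • g (t•σ y)`), lit ✓`SobolevDomainProofs` (`HasWeakFDerivOn.of_contDiff_holds` =
integration by parts for `C¹` functions), Mathlib (the fundamental lemma of the calculus of variations, Fubini).

WHAT THIS FILE PROVES — the two identities that make the transport of brick (T) «test side only»:
* ★★ `integral_div_smul_eq_neg_integral_weakGrad` — THE WEAK GRADIENT AGAINST A VECTOR FIELD: for `U` with weak gradient `G` on
  `Ω` and a smooth vector field `Z` whose components are test functions on `Ω`, `∫ (div Z) • U = −∫ G_x(Z x) dx`;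
* ★★★ `div_coneField_ae_eq` — THE PUSH-FORWARD OF `∂_v`: for `χ ∈ C^∞` supported in `[a,b] ⊂ (0,∞)`, `φ ∈ C_c^∞(E²)`, `v ∈ E²`,
  the cone cut-off field `Z(x) = χ(‖x‖) φ(π x) · ‖x‖∕(‖x‖+x₂)² · Dσ_{πx}(v)` (the push-forward of `J⁻¹χφ ∂_v` under `(t,y) ↦ t•σ y`,
  `J = t²c²`) has `div Z = χ(‖x‖) (∂_vφ)(π x) ∕ (‖x‖+x₂)²` ALMOST EVERYWHERE — proved WEAKLY: against every test `θ` both sides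
  integrate to `∫_{(0,∞)×E²} χ(t) ∂_vφ(y) θ(t•σ y)`, by integration by parts on `E³`, the change of variables, Fubini, and integration
  by parts on `E²`; no coordinate computation of a divergence.

HONEST SCOPE.  Calculus ∕ measure theory; nothing of (GAP)∕(TM), (C), S1″, K1, `MeanDeviationL`, `BlockLipschitzL`, `HistoryTailL` is
proved here.  YM₃ on T³ is rung R3, not Clay; YM gap NOT proved; no summit statement is proved here.

References: L. C. Evans, Partial Differential Equations, 2nd ed. (2010) [Evans2010] (§5.2.1, App. C.2); L. Simon, Theorems on
Regularity and Singularity of Energy Minimizing Maps (1996) [Simon1996] (§3.1).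
-/

set_option autoImplicit false

noncomputable section

open MeasureTheory Set Function Filter Topology Metric TopologicalSpace
open scoped RealInnerProductSpace BigOperators ContDiff

namespace Summit.QuantumFields.YangMills.Theorems.PoincareLipschitzConeLinkPushforward

open Literature.Analysis.FunctionSpaces (IsTestFunctionOn HasWeakFDerivOn)
open Summit.QuantumFields.YangMills.Theorems.PoincareLipschitzConeLinkChart
open Summit.QuantumFields.YangMills.Theorems.PoincareLipschitzConeLinkCutoff
open Summit.QuantumFields.YangMills.Theorems.PoincareLipschitzConeLinkDilationLetters
  (setIntegral_smul_eq_integral integrable_smul_of_locallyIntegrableOn)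

variable {c : EuclideanSpace ℝ (Fin 2) → ℝ} {σ : EuclideanSpace ℝ (Fin 2) → EuclideanSpace ℝ (Fin 3)}
  {π : EuclideanSpace ℝ (Fin 3) → EuclideanSpace ℝ (Fin 2)}

/-! ## §1 The weak gradient tested against a vector field -/

/-- `Σ_i (Z x)_i • e_i = Z x` in `E³`. [folklore] -/
theorem sum_apply_smul_single (z : EuclideanSpace ℝ (Fin 3)) :
    ∑ i : Fin 3, z i • EuclideanSpace.single i (1:ℝ) = z := by
  have h := (EuclideanSpace.basisFun (Fin 3) ℝ).sum_repr z
  simpa only [EuclideanSpace.basisFun_repr, EuclideanSpace.basisFun_apply] using h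

/-- ★★ **THE WEAK GRADIENT AGAINST A VECTOR FIELD.**  For `U` with weak gradient `G` on `Ω` and a vector field `Z : E³ → E³` whose
components are test functions on `Ω`: `∫ (Σ_i ∂_i Z_i) • U = −∫ G_x (Z x) dx` (sum of the three weak-gradient identities).
[cite: Evans2010, §5.2.1] -/
theorem integral_div_smul_eq_neg_integral_weakGrad {F : Type*} [NormedAddCommGroup F] [NormedSpace ℝ F] [CompleteSpace F]
    {Ω : Opens (EuclideanSpace ℝ (Fin 3))} {U : EuclideanSpace ℝ (Fin 3) → F}
    {G : EuclideanSpace ℝ (Fin 3) → EuclideanSpace ℝ (Fin 3) →L[ℝ] F} (hU : HasWeakFDerivOn Ω volume U G)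
    {Z : EuclideanSpace ℝ (Fin 3) → EuclideanSpace ℝ (Fin 3)} (hZ : ∀ i : Fin 3, IsTestFunctionOn Ω (fun x => Z x i)) :
    ∫ x, (∑ i : Fin 3, fderiv ℝ (fun x => Z x i) x (EuclideanSpace.single i (1:ℝ))) • U x = -∫ x, G x (Z x) := by
  -- each component identity, as whole-space integrals
  have hw : ∀ i : Fin 3, ∫ x, (fderiv ℝ (fun x => Z x i) x (EuclideanSpace.single i (1:ℝ))) • U x =
      -∫ x, (Z x i) • G x (EuclideanSpace.single i (1:ℝ)) := by
    intro i
    have h := hU.integral_fderiv_smul_eq _ (EuclideanSpace.single i (1:ℝ)) (hZ i)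
    rwa [setIntegral_smul_eq_integral ((tsupport_fderiv_apply_subset ℝ _).trans (hZ i).tsupport_subset),
      setIntegral_smul_eq_integral (hZ i).tsupport_subset] at h
  -- integrability of the summands
  have hI : ∀ i : Fin 3, Integrable (fun x => (fderiv ℝ (fun x => Z x i) x (EuclideanSpace.single i (1:ℝ))) • U x) volume := by
    intro i
    exact integrable_smul_of_locallyIntegrableOn hU.locallyIntegrableOn
      (((hZ i).contDiff.continuous_fderiv (by simp)).clm_apply continuous_const)
      ((hZ i).hasCompactSupport.fderiv_apply (𝕜 := ℝ) _)
      ((tsupport_fderiv_apply_subset ℝ _).trans (hZ i).tsupport_subset)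
  have hI' : ∀ i : Fin 3, Integrable (fun x => (Z x i) • G x (EuclideanSpace.single i (1:ℝ))) volume := by
    intro i
    exact integrable_smul_of_locallyIntegrableOn
      ((ContinuousLinearMap.apply ℝ F (EuclideanSpace.single i (1:ℝ))).locallyIntegrableOn_comp hU.locallyIntegrableOn_deriv)
      (hZ i).contDiff.continuous (hZ i).hasCompactSupport (hZ i).tsupport_subset
  simp_rw [Finset.sum_smul]
  rw [integral_finsetSum _ (fun i _ => hI i)]
  simp_rw [hw]
  rw [Finset.sum_neg_distrib, ← integral_finsetSum _ (fun i _ => hI' i)]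
  congr 1
  refine integral_congr_ae (Filter.Eventually.of_forall fun x => ?_)
  have h := congrArg (G x) (sum_apply_smul_single (Z x))
  rw [map_sum] at h
  simpa only [map_smul] using h

/-! ## §2 Whole-space integrals through the chart -/

/-- **Change of variables for whole-space integrals**: `∫ g = ∫_{(0,∞)×E²} (t²c(y)²) • g (t•σ y)` (the origin is null).
[cite: Evans2010, App. C.2] -/
theorem integral_eq_integral_chart {F : Type*} [NormedAddCommGroup F] [NormedSpace ℝ F]
    (hc : ∀ y, c y = 2 / (1 + ‖y‖ ^ 2)) (hσ : ∀ y, σ y = !₂[c y * y 0, c y * y 1, c y - 1])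
    (g : EuclideanSpace ℝ (Fin 3) → F) :
    ∫ x, g x = ∫ q in Ioi (0:ℝ) ×ˢ (univ : Set (EuclideanSpace ℝ (Fin 2))), (q.1 ^ 2 * c q.2 ^ 2) • g (q.1 • σ q.2) := by
  have h0 : ∀ᵐ x ∂(volume : Measure (EuclideanSpace ℝ (Fin 3))), x ∈ {x : EuclideanSpace ℝ (Fin 3) | ‖x‖ ∈ Ioi (0:ℝ)} := by
    have h : ∀ᵐ x ∂(volume : Measure (EuclideanSpace ℝ (Fin 3))), x ∉ ({0} : Set (EuclideanSpace ℝ (Fin 3))) :=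
      measure_eq_zero_iff_ae_notMem.1 (measure_singleton 0)
    filter_upwards [h] with x hx
    simpa [mem_setOf_eq, mem_Ioi, norm_pos_iff] using hx
  rw [← setIntegral_norm_mem_eq_integral_chart hc hσ measurableSet_Ioi Subset.rfl g,
    Measure.restrict_eq_self_of_ae_mem h0]

/-! ## §3 The push-forward of `∂_v` and its divergence -/

/-- **Geometry on the cone**: `‖t•σ y‖ + (t•σ y)₂ = t · c y` (`t > 0`). [folklore] -/
theorem norm_add_apply_two_smul_sigma (hc : ∀ y, c y = 2 / (1 + ‖y‖ ^ 2))
    (hσ : ∀ y, σ y = !₂[c y * y 0, c y * y 1, c y - 1]) {t : ℝ} (ht : 0 < t) (y : EuclideanSpace ℝ (Fin 2)) :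
    ‖t • σ y‖ + (t • σ y) 2 = t * c y := by
  rw [norm_smul_sigma hc hσ, abs_of_pos ht, hσ y]
  simp [PiLp.smul_apply]
  ring

/-- **Components of a vector-valued test function are test functions.** [cite: Evans2010, §5.2.1] -/
theorem isTestFunctionOn_apply {Ω : Opens (EuclideanSpace ℝ (Fin 3))} {Z : EuclideanSpace ℝ (Fin 3) → EuclideanSpace ℝ (Fin 3)}
    (hZ : IsTestFunctionOn Ω Z) (i : Fin 3) : IsTestFunctionOn Ω (fun x => Z x i) := by
  refine ⟨(contDiff_apply_three i).comp hZ.contDiff, ?_, ?_⟩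
  · exact hZ.hasCompactSupport.comp_left (g := fun z : EuclideanSpace ℝ (Fin 3) => z i) rfl
  · refine (closure_mono ?_).trans hZ.tsupport_subset
    intro x hx h0
    exact hx (by simp [h0])

/-- The test-function data for this file's integrands: a product `χ(t) · ψ(y) · h(t,y)` with `χ` supported in `[a,b]`, `ψ`
compactly supported and `h` continuous is integrable on `ℝ × E²` (continuous with compact support). [folklore] -/
theorem integrable_prod_cutoff {χ : ℝ → ℝ} (hχ : Continuous χ) {a b : ℝ} (hχs : tsupport χ ⊆ Icc a b)
    {ψ : EuclideanSpace ℝ (Fin 2) → ℝ} (hψ : Continuous ψ) (hψc : HasCompactSupport ψ)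
    {h : ℝ × EuclideanSpace ℝ (Fin 2) → ℝ} (hh : Continuous h) :
    Integrable (fun q : ℝ × EuclideanSpace ℝ (Fin 2) => χ q.1 * (ψ q.2 * h q)) := by
  have hcont : Continuous fun q : ℝ × EuclideanSpace ℝ (Fin 2) => χ q.1 * (ψ q.2 * h q) :=
    (hχ.comp continuous_fst).mul ((hψ.comp continuous_snd).mul hh)
  refine hcont.integrable_of_hasCompactSupport ?_
  refine HasCompactSupport.intro ((isCompact_Icc (a := a) (b := b)).prod hψc.isCompact) fun q hq => ?_
  rw [mem_prod, not_and_or] at hq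
  rcases hq with h1 | h2
  · rw [image_eq_zero_of_notMem_tsupport (fun h => h1 (hχs h)), zero_mul]
  · rw [image_eq_zero_of_notMem_tsupport h2, zero_mul, mul_zero]

/-- ★★★ **THE PUSH-FORWARD OF `∂_v` IS DIVERGENCE-FREE UP TO THE SOURCE `∂_vφ`.**  For `χ ∈ C^∞(ℝ)` with `tsupport χ ⊆ [a,b]`,
`0 < a`, `φ ∈ C_c^∞(E²)` and `v ∈ E²`, the cone cut-off vector field
`Z(x) := χ(‖x‖) φ(π x) · (‖x‖ ∕ (‖x‖+x₂)²) · Dσ_{π x}(v)` (zero off `V`) satisfies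
`Σ_i ∂_i Z_i = χ(‖x‖) · (∂_vφ)(π x) ∕ (‖x‖+x₂)²` for a.e. `x` — both sides pair with every test `θ` to
`∫_{(0,∞)×E²} χ(t) ∂_vφ(y) θ(t•σ y)`. [cite: Evans2010, App. C.2 (change of variables) and §5.2.1] -/
theorem div_coneField_ae_eq (hc : ∀ y, c y = 2 / (1 + ‖y‖ ^ 2))
    (hσ : ∀ y, σ y = !₂[c y * y 0, c y * y 1, c y - 1])
    (hπ : ∀ x, π x = (‖x‖ + x 2)⁻¹ • !₂[x 0, x 1])
    {χ : ℝ → ℝ} (hχ : ContDiff ℝ ∞ χ) {a b : ℝ} (ha : 0 < a) (hχs : tsupport χ ⊆ Icc a b)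
    {φ : EuclideanSpace ℝ (Fin 2) → ℝ} (hφ : ContDiff ℝ ∞ φ) (hφc : HasCompactSupport φ) (v : EuclideanSpace ℝ (Fin 2)) :
    (fun x => ∑ i : Fin 3, fderiv ℝ (fun x => ({x : EuclideanSpace ℝ (Fin 3) | 0 < ‖x‖ + x 2}.indicator
        (fun x => (χ ‖x‖ * φ (π x)) • ((((‖x‖ + x 2) ^ 2)⁻¹ * ‖x‖) • fderiv ℝ σ (π x) v)) x) i) x
        (EuclideanSpace.single i (1:ℝ)))
      =ᵐ[volume] {x : EuclideanSpace ℝ (Fin 3) | 0 < ‖x‖ + x 2}.indicator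
        (fun x => (χ ‖x‖ * fderiv ℝ φ (π x) v) • ((‖x‖ + x 2) ^ 2)⁻¹) := by
  set V : Set (EuclideanSpace ℝ (Fin 3)) := {x | 0 < ‖x‖ + x 2} with hV
  set gZ : EuclideanSpace ℝ (Fin 3) → EuclideanSpace ℝ (Fin 3) :=
    fun x => (((‖x‖ + x 2) ^ 2)⁻¹ * ‖x‖) • fderiv ℝ σ (π x) v with hgZ
  set Z : EuclideanSpace ℝ (Fin 3) → EuclideanSpace ℝ (Fin 3) := V.indicator (fun x => (χ ‖x‖ * φ (π x)) • gZ x) with hZ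
  set Ψ : EuclideanSpace ℝ (Fin 3) → ℝ := V.indicator (fun x => (χ ‖x‖ * fderiv ℝ φ (π x) v) • ((‖x‖ + x 2) ^ 2)⁻¹) with hΨ
  -- smoothness data
  have hσs := contDiff_sigma hc hσ
  have hV0 : ∀ x ∈ V, x ≠ 0 := by
    rintro x hx rfl
    simp [hV] at hx
  have hJinv : ContDiffOn ℝ ∞ (fun x : EuclideanSpace ℝ (Fin 3) => ((‖x‖ + x 2) ^ 2)⁻¹) V := by
    refine ((contDiffOn_id.norm ℝ hV0).add (contDiff_apply_three 2).contDiffOn).pow 2 |>.inv fun x hx => ?_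
    exact pow_ne_zero 2 (ne_of_gt hx)
  have hgZs : ContDiffOn ℝ ∞ gZ V := by
    refine (hJinv.mul (contDiffOn_id.norm ℝ hV0)).smul ?_
    exact ((hσs.fderiv_right le_rfl).comp_contDiffOn (contDiffOn_pi hπ)).clm_apply contDiffOn_const
  have hφ' : ContDiff ℝ ∞ fun y => fderiv ℝ φ y v := (hφ.fderiv_right le_rfl).clm_apply contDiff_const
  have hφ'c : HasCompactSupport fun y => fderiv ℝ φ y v := hφc.fderiv_apply (𝕜 := ℝ) v
  have hZt : IsTestFunctionOn (⊤ : Opens (EuclideanSpace ℝ (Fin 3))) Z :=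
    isTestFunctionOn_coneCutoff hπ hχ ha hχs hφ hφc hgZs (Ω := ⊤) (subset_univ _)
  have hΨt : IsTestFunctionOn (⊤ : Opens (EuclideanSpace ℝ (Fin 3))) Ψ :=
    isTestFunctionOn_coneCutoff hπ hχ ha hχs hφ' hφ'c hJinv (Ω := ⊤) (subset_univ _)
  have hZi : ∀ i : Fin 3, IsTestFunctionOn (⊤ : Opens (EuclideanSpace ℝ (Fin 3))) (fun x => Z x i) :=
    fun i => isTestFunctionOn_apply hZt i
  -- values on the cone
  have hZΦ : ∀ {t : ℝ} (ht : 0 < t) (y : EuclideanSpace ℝ (Fin 2)),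
      Z (t • σ y) = ((χ t * φ y) * (((t * c y) ^ 2)⁻¹ * t)) • fderiv ℝ σ y v := by
    intro t ht y
    rw [hZ, coneCutoff_smul_sigma hc hσ hπ χ φ gZ ht y, hgZ]
    simp only
    rw [norm_add_apply_two_smul_sigma hc hσ ht, norm_smul_sigma hc hσ, abs_of_pos ht, pi_smul_sigma hc hσ hπ ht,
      smul_smul]
  have hΨΦ : ∀ {t : ℝ} (ht : 0 < t) (y : EuclideanSpace ℝ (Fin 2)),
      Ψ (t • σ y) = (χ t * fderiv ℝ φ y v) * ((t * c y) ^ 2)⁻¹ := by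
    intro t ht y
    rw [hΨ, coneCutoff_smul_sigma hc hσ hπ χ (fun y => fderiv ℝ φ y v) (fun x => ((‖x‖ + x 2) ^ 2)⁻¹) ht y,
      norm_add_apply_two_smul_sigma hc hσ ht, smul_eq_mul]
  -- the Jacobian cancels
  have hJ : ∀ {t : ℝ} (ht : 0 < t) (y : EuclideanSpace ℝ (Fin 2)), (t ^ 2 * c y ^ 2) * (((t * c y) ^ 2)⁻¹ * t) = t := by
    intro t ht y
    have hc0 : c y ≠ 0 := (c_pos hc y).ne'
    field_simp
  have hJ' : ∀ {t : ℝ} (ht : 0 < t) (y : EuclideanSpace ℝ (Fin 2)), (t ^ 2 * c y ^ 2) * ((t * c y) ^ 2)⁻¹ = 1 := by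
    intro t ht y
    have hc0 : c y ≠ 0 := (c_pos hc y).ne'
    field_simp
  -- local integrability of both sides
  have hdivc : Continuous fun x => ∑ i : Fin 3, fderiv ℝ (fun x => Z x i) x (EuclideanSpace.single i (1:ℝ)) :=
    continuous_finsetSum _ fun i _ => ((hZi i).contDiff.continuous_fderiv (by simp)).clm_apply continuous_const
  refine ae_eq_of_integral_contDiff_smul_eq hdivc.locallyIntegrable hΨt.contDiff.continuous.locallyIntegrable
    fun θ hθ hθc => ?_
  have hθt : IsTestFunctionOn (⊤ : Opens (EuclideanSpace ℝ (Fin 3))) θ := ⟨hθ, hθc, subset_univ _⟩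
  have hθd : Differentiable ℝ θ := hθ.differentiable (by simp)
  -- (L1)–(L3): integrate by parts in `E³`, componentwise, and recollect `Dθ(Z x)`
  have hL : ∫ x, θ x • ∑ i : Fin 3, fderiv ℝ (fun x => Z x i) x (EuclideanSpace.single i (1:ℝ)) =
      -∫ x, fderiv ℝ θ x (Z x) := by
    have hibp : ∀ i : Fin 3, ∫ x, θ x * fderiv ℝ (fun x => Z x i) x (EuclideanSpace.single i (1:ℝ)) =
        -∫ x, fderiv ℝ θ x (EuclideanSpace.single i (1:ℝ)) * Z x i := by
      intro i
      have hw := Literature.Analysis.FunctionSpaces.HasWeakFDerivOn.of_contDiff_holds (⊤ : Opens (EuclideanSpace ℝ (Fin 3)))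
        volume ((hZi i).contDiff.of_le (by exact_mod_cast le_top))
      have h := hw.integral_fderiv_smul_eq θ (EuclideanSpace.single i (1:ℝ)) hθt
      simp only [Opens.coe_top, Measure.restrict_univ, smul_eq_mul] at h
      linarith
    have hI1 : ∀ i : Fin 3, Integrable (fun x => θ x * fderiv ℝ (fun x => Z x i) x (EuclideanSpace.single i (1:ℝ))) :=
      fun i => (hθ.continuous.mul (((hZi i).contDiff.continuous_fderiv (by simp)).clm_apply continuous_const))
        |>.integrable_of_hasCompactSupport (hθc.mul_right)
    have hI2 : ∀ i : Fin 3, Integrable (fun x => fderiv ℝ θ x (EuclideanSpace.single i (1:ℝ)) * Z x i) :=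
      fun i => (((hθ.continuous_fderiv (by simp)).clm_apply continuous_const).mul (hZi i).contDiff.continuous)
        |>.integrable_of_hasCompactSupport ((hZi i).hasCompactSupport.mul_left)
    simp_rw [smul_eq_mul, Finset.mul_sum]
    rw [integral_finsetSum _ (fun i _ => hI1 i)]
    simp_rw [hibp]
    rw [Finset.sum_neg_distrib, ← integral_finsetSum _ (fun i _ => hI2 i)]
    congr 1
    refine integral_congr_ae (Filter.Eventually.of_forall fun x => ?_)
    have h := congrArg (fderiv ℝ θ x) (sum_apply_smul_single (Z x))
    rw [map_sum] at h
    simp only [map_smul, smul_eq_mul] at h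
    show ∑ i : Fin 3, fderiv ℝ θ x (EuclideanSpace.single i (1:ℝ)) * Z x i = fderiv ℝ θ x (Z x)
    rw [← h]
    exact Finset.sum_congr rfl fun i _ => mul_comm _ _
  -- (L4)–(L5): through the chart, the integrand becomes `χ(t) φ(y) ∂_v(θ∘(t•σ))(y)`
  have hK : ∀ q : ℝ × EuclideanSpace ℝ (Fin 2), q ∈ Ioi (0:ℝ) ×ˢ (univ : Set (EuclideanSpace ℝ (Fin 2))) →
      (q.1 ^ 2 * c q.2 ^ 2) • fderiv ℝ θ (q.1 • σ q.2) (Z (q.1 • σ q.2)) =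
        χ q.1 * (φ q.2 * fderiv ℝ (fun y => θ (q.1 • σ y)) q.2 v) := by
    rintro ⟨t, y⟩ hq
    have ht : 0 < t := (mem_prod.1 hq).1
    simp only
    rw [hZΦ ht y, map_smul, smul_eq_mul, smul_eq_mul,
      fderiv_comp_smul_sigma hc hσ t y v (hθd _), map_smul, smul_eq_mul]
    have h := hJ ht y
    calc t ^ 2 * c y ^ 2 * (χ t * φ y * (((t * c y) ^ 2)⁻¹ * t) * (fderiv ℝ θ (t • σ y)) ((fderiv ℝ σ y) v))
        = χ t * φ y * ((t ^ 2 * c y ^ 2) * (((t * c y) ^ 2)⁻¹ * t)) * (fderiv ℝ θ (t • σ y)) ((fderiv ℝ σ y) v) := by ring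
      _ = χ t * (φ y * (t * (fderiv ℝ θ (t • σ y)) ((fderiv ℝ σ y) v))) := by rw [h]; ring
  -- (L6)–(L8): Fubini and integration by parts in `E²`
  have hchain : ∀ (t : ℝ) (y : EuclideanSpace ℝ (Fin 2)),
      fderiv ℝ (fun y => θ (t • σ y)) y v = fderiv ℝ θ (t • σ y) (t • fderiv ℝ σ y v) :=
    fun t y => fderiv_comp_smul_sigma hc hσ t y v (hθd _)
  have hcont1 : Continuous fun q : ℝ × EuclideanSpace ℝ (Fin 2) => fderiv ℝ (fun y => θ (q.1 • σ y)) q.2 v := by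
    simp_rw [hchain]
    have h1 : Continuous fun q : ℝ × EuclideanSpace ℝ (Fin 2) => q.1 • σ q.2 :=
      continuous_fst.smul (hσs.continuous.comp continuous_snd)
    exact ((hθ.continuous_fderiv (by simp)).comp h1).clm_apply
      (continuous_fst.smul (((hσs.continuous_fderiv (by simp)).comp continuous_snd).clm_apply continuous_const))
  have hcont2 : Continuous fun q : ℝ × EuclideanSpace ℝ (Fin 2) => θ (q.1 • σ q.2) :=
    hθ.continuous.comp (continuous_fst.smul (hσs.continuous.comp continuous_snd))
  have hInt1 := integrable_prod_cutoff hχ.continuous hχs hφ.continuous hφc hcont1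
  have hInt2 := integrable_prod_cutoff hχ.continuous hχs hφ'.continuous hφ'c hcont2
  have hibp2 : ∀ t : ℝ, ∫ y, φ y * fderiv ℝ (fun y => θ (t • σ y)) y v = -∫ y, fderiv ℝ φ y v * θ (t • σ y) := by
    intro t
    have hθt1 : ContDiff ℝ 1 (fun y => θ (t • σ y)) :=
      (hθ.of_le (by exact_mod_cast le_top)).comp ((hσs.of_le (by exact_mod_cast le_top)).const_smul t)
    have hw := Literature.Analysis.FunctionSpaces.HasWeakFDerivOn.of_contDiff_holds (⊤ : Opens (EuclideanSpace ℝ (Fin 2)))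
      volume hθt1
    have h := hw.integral_fderiv_smul_eq φ v ⟨hφ, hφc, subset_univ _⟩
    simp only [Opens.coe_top, Measure.restrict_univ, smul_eq_mul] at h
    linarith
  have hprod : (volume : Measure (ℝ × EuclideanSpace ℝ (Fin 2))) = (volume : Measure ℝ).prod volume := rfl
  have hLHS : ∫ q in Ioi (0:ℝ) ×ˢ (univ : Set (EuclideanSpace ℝ (Fin 2))),
      χ q.1 * (φ q.2 * fderiv ℝ (fun y => θ (q.1 • σ y)) q.2 v) =
      -∫ q in Ioi (0:ℝ) ×ˢ (univ : Set (EuclideanSpace ℝ (Fin 2))), χ q.1 * (fderiv ℝ φ q.2 v * θ (q.1 • σ q.2)) := by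
    rw [hprod, setIntegral_prod _ hInt1.integrableOn, setIntegral_prod _ hInt2.integrableOn, ← integral_neg]
    refine setIntegral_congr_fun measurableSet_Ioi fun t _ => ?_
    simp only [Measure.restrict_univ]
    rw [integral_const_mul, integral_const_mul, hibp2 t, mul_neg]
  -- assemble
  rw [integral_eq_integral_chart hc hσ (fun x => θ x • Ψ x)]
  have hR : ∫ q in Ioi (0:ℝ) ×ˢ (univ : Set (EuclideanSpace ℝ (Fin 2))),
      (q.1 ^ 2 * c q.2 ^ 2) • (θ (q.1 • σ q.2) • Ψ (q.1 • σ q.2)) =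
      ∫ q in Ioi (0:ℝ) ×ˢ (univ : Set (EuclideanSpace ℝ (Fin 2))), χ q.1 * (fderiv ℝ φ q.2 v * θ (q.1 • σ q.2)) := by
    refine setIntegral_congr_fun (measurableSet_Ioi.prod MeasurableSet.univ) ?_
    rintro ⟨t, y⟩ hq
    have ht : 0 < t := (mem_prod.1 hq).1
    simp only [smul_eq_mul]
    rw [hΨΦ ht y]
    have h := hJ' ht y
    calc t ^ 2 * c y ^ 2 * (θ (t • σ y) * (χ t * fderiv ℝ φ y v * ((t * c y) ^ 2)⁻¹))
        = (t ^ 2 * c y ^ 2 * ((t * c y) ^ 2)⁻¹) * (χ t * (fderiv ℝ φ y v * θ (t • σ y))) := by ring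
      _ = χ t * (fderiv ℝ φ y v * θ (t • σ y)) := by rw [h, one_mul]
  rw [hR, hL, integral_eq_integral_chart hc hσ (fun x => fderiv ℝ θ x (Z x)),
    setIntegral_congr_fun (measurableSet_Ioi.prod MeasurableSet.univ) hK, hLHS, neg_neg]

end Summit.QuantumFields.YangMills.Theorems.PoincareLipschitzConeLinkPushforward

end
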